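import Mathlib

/-!
# T5WedgeDet — the wedge of two (1,0)-forms is the 2×2 minor (N1 §ID-4(b)–(c), D8)

Prose step (route/T5-ID-p2.md v7.1, ID-4(b)): under Borel–Wallach I.1.6 / VII.2.5 / II.4 (3) a
(1,0)-form on `Γ\𝔹²` is a `K₁`-equivariant function with values in `(𝔭⁺)^*`, `𝔭⁺` of dimension 2;
the wedge of two such forms is the pointwise exterior product with values in the one-dimensional
space `∧²(𝔭⁺)^*`, i.e. — after fixing a basis `(e₀, e₁)` of `𝔭⁺` and the basis vector
`ϵ = e₀^* ∧ e₁^*` — the scalar function «the 2×2 minor of the matrix of components»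
`F(e₀)F′(e₁) − F(e₁)F′(e₀)` (dictionary row D8: `Δ = w₁₁w₂₂ − w₁₂w₂₁`).

Formalised here for an arbitrary field `K` and `K`-vector space `V` (the role of `𝔭⁺`): the wedge
`f ∧ g` of two linear forms as an alternating 2-form (Mathlib's alternatization of the product),
its value as a `2×2` determinant, and — when `V` has a basis indexed by `Fin 2` — the identity
`f ∧ g = (f e₀ · g e₁ − f e₁ · g e₀) • e.det` with `e.det` the basis determinant form (the unit
basis vector `ϵ` of `∧²V^*`). The pointwise version for `V^*`-valued functions on a set `X`
(the automorphic functions of ID-4(b)) is the last theorem.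
-/

namespace Summit.Ventures.HodgeRepro2.T5WedgeDet

open MultilinearMap Module

variable {K V : Type*} [Field K] [AddCommGroup V] [Module K V]

/-- The product bilinear form `(v₀, v₁) ↦ f v₀ · g v₁` as a multilinear map on `Fin 2 → V`. -/
noncomputable def prodForm (f g : V →ₗ[K] K) : MultilinearMap K (fun _ : Fin 2 => V) K :=
  (MultilinearMap.mkPiAlgebra K (Fin 2) K).compLinearMap ![f, g]

/-- `prodForm f g v = f (v 0) * g (v 1)`. -/
theorem prodForm_apply (f g : V →ₗ[K] K) (v : Fin 2 → V) :
    prodForm f g v = f (v 0) * g (v 1) := by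
  simp [prodForm, Fin.prod_univ_two]

/-- The wedge `f ∧ g` of two linear forms, as an alternating 2-form: the alternatization
`Σ_σ sign σ • (prodForm f g) ∘ σ` of the product. -/
noncomputable def wedge (f g : V →ₗ[K] K) : V [⋀^Fin 2]→ₗ[K] K :=
  MultilinearMap.alternatization (prodForm f g)

/-- The wedge evaluated at `(v 0, v 1)` is the determinant of the `2×2` matrix of components
`(f (v i), g (v i))_i` — «the 2×2 minor of the matrix of components» (D8). -/
theorem wedge_apply_eq_det (f g : V →ₗ[K] K) (v : Fin 2 → V) :
    wedge f g v = Matrix.det (Matrix.of fun i j : Fin 2 => (![f, g] j) (v i)) := by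
  rw [wedge, alternatization_apply, Matrix.det_apply]
  refine Finset.sum_congr rfl fun σ _ => ?_
  simp [prodForm, Fin.prod_univ_two]

/-- The explicit formula `(f ∧ g)(v₀, v₁) = f v₀ · g v₁ − f v₁ · g v₀`. -/
theorem wedge_apply (f g : V →ₗ[K] K) (v : Fin 2 → V) :
    wedge f g v = f (v 0) * g (v 1) - f (v 1) * g (v 0) := by
  rw [wedge_apply_eq_det, Matrix.det_fin_two]
  simp only [Matrix.of_apply, Matrix.cons_val_zero, Matrix.cons_val_one]
  ring

/-- Antisymmetry `g ∧ f = −(f ∧ g)`. -/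
theorem wedge_swap (f g : V →ₗ[K] K) : wedge g f = -wedge f g := by
  ext v
  simp only [wedge_apply, AlternatingMap.neg_apply]
  ring

/-- `f ∧ f = 0`. -/
theorem wedge_self (f : V →ₗ[K] K) : wedge f f = 0 := by
  ext v
  simp only [wedge_apply, AlternatingMap.zero_apply]
  ring

/-- The minor of two linear forms with respect to a basis `e` indexed by `Fin 2`:
`f (e 0) · g (e 1) − f (e 1) · g (e 0)`. -/
noncomputable def minor (e : Basis (Fin 2) K V) (f g : V →ₗ[K] K) : K :=
  f (e 0) * g (e 1) - f (e 1) * g (e 0)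

/-- With respect to a basis `e = (e₀, e₁)` of `V` (dimension 2), the wedge of two linear forms is
the minor times the basis determinant form `e.det` — the unit basis vector `ϵ` of the
one-dimensional space of alternating 2-forms (ID-4(b): «a (2,0)-form is the scalar function
`F/ϵ`»). Mathlib: `AlternatingMap.eq_smul_basis_det`. -/
theorem wedge_eq_minor_smul_det (e : Basis (Fin 2) K V) (f g : V →ₗ[K] K) :
    wedge f g = minor e f g • e.det := by
  rw [AlternatingMap.eq_smul_basis_det e (wedge f g), minor, wedge_apply]

/-- The scalar component of the wedge: evaluating at the basis gives exactly the minor. -/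
theorem wedge_apply_basis (e : Basis (Fin 2) K V) (f g : V →ₗ[K] K) :
    wedge f g e = minor e f g := by
  rw [wedge_apply, minor]

/-- The pointwise version for `V^*`-valued functions `F, F′` on a set `X` (the `(𝔭⁺)^*`-valued
automorphic functions representing two (1,0)-forms): the pointwise wedge is the pointwise minor
times the fixed basis vector `e.det`. -/
theorem pointwise_wedge_eq (e : Basis (Fin 2) K V) {X : Type*} (F F' : X → V →ₗ[K] K) :
    (fun x => wedge (F x) (F' x)) = fun x => minor e (F x) (F' x) • e.det := by
  funext x
  exact wedge_eq_minor_smul_det e (F x) (F' x)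

/-- Bilinearity of the minor in the two forms (the wedge is bilinear: needed for «linearity in
`φ`» of the vertex data, ID-3(c)/ID-5). -/
theorem minor_add_left (e : Basis (Fin 2) K V) (f f' g : V →ₗ[K] K) :
    minor e (f + f') g = minor e f g + minor e f' g := by
  simp only [minor, LinearMap.add_apply]
  ring

/-- Bilinearity of the minor: scalar multiples in the first form. -/
theorem minor_smul_left (e : Basis (Fin 2) K V) (c : K) (f g : V →ₗ[K] K) :
    minor e (c • f) g = c * minor e f g := by
  simp only [minor, LinearMap.smul_apply, smul_eq_mul]
  ring

/-- Bilinearity of the minor in the second form. -/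
theorem minor_add_right (e : Basis (Fin 2) K V) (f g g' : V →ₗ[K] K) :
    minor e f (g + g') = minor e f g + minor e f g' := by
  simp only [minor, LinearMap.add_apply]
  ring

/-- Bilinearity of the minor: scalar multiples in the second form. -/
theorem minor_smul_right (e : Basis (Fin 2) K V) (c : K) (f g : V →ₗ[K] K) :
    minor e f (c • g) = c * minor e f g := by
  simp only [minor, LinearMap.smul_apply, smul_eq_mul]
  ring

end Summit.Ventures.HodgeRepro2.T5WedgeDet
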